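import Summits.QuantumAdvantage.QuantumAdvantage.Theses.MobiusLadder
import Summits.QuantumAdvantage.QuantumAdvantage.Theorems.MobiusLadderDigitPolyUniformityStubEnds
import Summits.QuantumAdvantage.QuantumAdvantage.Theorems.MobiusLadderDigitPolyUniformityStubBsz
import Summits.QuantumAdvantage.QuantumAdvantage.Theorems.MobiusLadderDigitPolyUniformityWalshGapped
import Literature.NumberTheory.Sieve.BourgainSarnakZieglerCriterionProofs
import Literature.NumberTheory.LFunctions.LiouvilleTwoPowerModuli
import Literature.NumberTheory.LFunctions.LiouvilleSumClassicalBound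

/-!
# `DigitPolyUniformity` (stmt-QuantumAdvantage-1392) — line `Sketch` (card `katai-transducer-dichotomy`):
# reduction skeleton, reshaped by the line lead

Crux `Summit.QuantumAdvantage.QuantumAdvantage.Theses.MobiusLadder.DigitPolyUniformity` (route
`MobiusLadder`, rank 4): for every `A` and `ε > 0`, eventually in `n`, every `P ∈ 𝔽₂[x_0..x_{n−1}]`
of total degree `≤ (log₂ n)^A` has `|Σ_{N<2^n} λ(N)(−1)^{P(bits N)}| ≤ ε 2^n`.

The line: eliminate `λ` by the finite Kátai–Bourgain–Sarnak–Ziegler criterion (PROVED in the tree: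
`Literature.NumberTheory.Sieve.BourgainSarnakZiegler.norm_sum_le_of_goodN`,
`….bourgainSarnakZiegler_criterion_holds`), after projecting the phase `F = (−1)^{P∘bits}` onto the
TWO-ENDS σ-algebra generated by the low `k` and the high `m` binary digits, on whose atoms
(progressions mod `2^k` ∩ intervals of length `2^{n−m}`) `λ` is equidistributed by the tree's
PROVED prime-number theorem for `λ` twisted by characters to `2`-power moduli
(`Literature.NumberTheory.LFunctions.LiouvilleTwoPower.norm_sum_liouville_character_le`, Green 2012
Thm 3 / Montgomery–Vaughan §11.3.1 Ex. 6: moduli `2^k ≤ e^{c√log x}`, saving `e^{−c√log x}`).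

RESHAPING (lead, cycle 1). The card's transfer target `C⁺` used the two ends at BOUNDED depth
`K = K(A, τ)`. That statement is FALSE: an `𝔽₂`-polynomial of degree `O(log n)` in the TOP
`O(log n)` digits computes the "Benford chirp" `N ↦ sgn sin(2π n log₂ N)` (an archimedean character
`N^{iT}`, `T ≍ n`), and one of degree `(log₂ n)^A` in the BOTTOM `(log₂ n)^A` digits computes a
"2-adic chirp" `N ↦ sgn Re χ(N)`, `χ` a character of conductor `2^{(log₂ n)^A}`; both have prime
dilates that stay perfectly correlated at suitable pairs `(p, q)` (`T log(q/p) ∈ 2πℤ + o(1)`, resp.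
`χ(q/p) ≈ 1`), for infinitely many `n`, while having NO bounded-depth ends structure — and no Kátai
argument can see the difference between `λ` and `N^{iT}` / `χ`. Hence the ends σ-algebra must have
depth GROWING with `n` at both ends; the tree's `2`-power-moduli PNT allows any depths with
`k + m ≤ n^{1/3}` (indeed `≪ √n`), which swallows every function of `≤ (log₂ n)^A` extreme digits.
The stubs below are stated accordingly (`stub_ends`, `stub_transfer`).

* `stub_bsz` — the finite Kátai–BSZ criterion for `λ`, UNIFORM in the test function (explicit
  threshold), with a free lower cutoff `D` on the primes used and a free THIN exceptional set `B` of
  primes (`Σ_{p∈B} 1/p ≤ 1` on finite subsets) that are never used: provable now from the tree's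
  `BourgainSarnakZiegler.norm_sum_le_of_goodN` + Mertens window bounds (blocks of `H_b(ε)`
  consecutive admissible primes `> D`, `τ = τ(ε)` independent of `D` and `B`). LANDED (p103275).
  WHY `B` (lead, cycle 1): already for DEGREE ONE the sup over all prime pairs is hopeless — the
  dilate correlation of `w_{{i,i+j}}` at a pair `(p, q)` equals the doubling-map Riesz product
  `∫₀¹ σ(u)σ(2^j u) du`, `σ(u) = (−1)^{⌊pu⌋+⌊qu⌋}`, which is `≈ 0.33/(|p−2^j|·|q−2^j|)` when both
  primes sit next to the same power of two (`(29,31)`: 0.1255 measured; `(65537, 65539)` likewise),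
  and whether such pairs exist beyond every `D` is an open question about primes; they form a thin
  set, so the criterion simply avoids them.
* `stub_ends` — `λ` is equidistributed on the atoms of the two-ends σ-algebra at all depths
  `(k + m)^3 ≤ n`, uniformly: LANDED (p102479, `Theorems/MobiusLadderDigitPolyUniformityStubEnds.lean`,
  from `green_liouville_character_twoPower_holds` + the tree's progression transport).
* `stub_transfer` — the λ-free ENDS DICHOTOMY for prime dilates of low-degree digital phases (the
  open heart of the line; lead's stub): `F_P = g(ends) + 2G + E` with `Σ|E| ≤ τ2^n` and all prime-pair
  dilate correlations of `G` at primes in `(D, H]` at most `τ`.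
* `stub_singleDigit` — prime dilates of a single binary digit decorrelate
  (`|Σ_{m≤M} (−1)^{bit_j(pm)+bit_j(qm)}| ≤ C M/(pq) + C M q²(j+1)/2^j + C 2^j`): the base case of the
  transfer ("archimedean junk is integrable"), registered as a support; not consumed by
  `DigitPolyUniformity_of`.
* `stub_walshGapped` — prime dilates of GAP-SEPARATED Walsh characters have correlation
  `(pq)^{−#S}` up to `(M+1)#S·2(p+q)/2^G + 2^{L+1}`: the degree-one, gapped case of the transfer,
  LANDED (lead, p104199 + p105522; the cancellation identity + Riesz product along the doubling map).
* `stub_rieszWalsh` — the degree-one core of the transfer in Riesz-product form (OPEN; support):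
  `|Σ_{x<2^L} Π_{i∈S} φ_i(x)| ≤ τ2^L` for every nonempty `S ⊆ [k₀(τ,H), L)`, prime pairs above `D₀(τ)`
  outside a thin `B` — dense clusters included.
* `DigitPolyUniformity_of` — the composition, PROVED below from the first three stubs.
-/

noncomputable section

namespace Summit.QuantumAdvantage.DigitPolyUniformity.Sketch

open Filter Finset
open Summit.QuantumAdvantage.QuantumAdvantage.Theses.MobiusLadder (DigitPolyUniformity)

/-! ### The stubs -/

/-! `stub_bsz` (the finite Kátai–BSZ criterion for `λ`, uniform in the test function, with free lower
cutoff `D` and free thin exceptional prime set `B`: `∀ ε>0 ∃ τ>0 ∃ D₁ ∀ D ≥ D₁ ∀ B thin ∃ H N₀ ∀ N ≥ N₀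
∀ F 1-bdd, (pair decorrelation at primes of (D,H] ∖ B at length N/q) → |Σ_{m≤N} λ(m)F(m)| ≤ εN`) is
LANDED: `Summits/QuantumAdvantage/QuantumAdvantage/Theorems/MobiusLadderDigitPolyUniformityStubBsz.lean`
(worker-bsz, p103275; parameters L₁ = max 20 (log(8/ε)+1), τ = ε²/(256 L₁), blocks of ⌈256 L₁/ε²⌉
admissible primes of (D, exp(log D·e^{L₁+2})] ∖ B), imported above under the same name. -/

/-! `stub_ends` (ends equidistribution of `λ` at growing depth: `∀ ε>0, ∀ᶠ n, ∀ k m, (k+m)^3 ≤ n →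
∀ g 1-bdd, |Σ_{N<2^n} λ(N) g(N % 2^k, N / 2^(n−m))| ≤ ε 2^n`) is LANDED:
`Summits/QuantumAdvantage/QuantumAdvantage/Theorems/MobiusLadderDigitPolyUniformityStubEnds.lean`
(worker-ends, p102479), imported above under the same name. -/

/-- **Stub (the λ-free ends dichotomy for prime dilates of low-degree digital phases — OPEN, the
lead's stub).** For every `A` and `τ > 0` there are `D₀` and a thin exceptional set of primes `B`
(`Σ_{p∈T} 1/p ≤ 1` for finite `T ⊆ B`; intended: primes with a small odd multiple that is a sparse
signed sum of powers of two — the arithmetic coincidences `p ≈ 2^j ≈ q` that make doubling-map Riesz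
products large) such that for all `D ≥ D₀` and `H`,
eventually in `n`, every `P` of total degree `≤ (log₂ n)^A` admits a decomposition of its phase
`F_P(N) = (−1)^{P(bits N)}` on `[0, 2^n)` as `F_P = g(N mod 2^k, ⌊N/2^{n−m}⌋) + 2 G + E` with ends
depths `(k + m)^3 ≤ n`, `g, G` `1`-bounded, `Σ_{N<2^n} |E(N)| ≤ τ 2^n`, and ALL prime-pair dilate
correlations of `G` at the admissible primes of `(D, H]` small:
`|Σ_{1 ≤ m' ≤ (2^n−1)/q} G(pm')G(qm')| ≤ τ ⌊(2^n−1)/q⌋` for primes `D < p < q ≤ H` not in `B`.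
(Structure = the two ends at depth `o(n^{1/3})`, which is forced: Benford chirps `sgn sin(2πn log₂ N)`
and 2-adic chirps `sgn Re χ(N)`, `cond χ = 2^{(log₂ n)^A}`, are low-degree phases with perfectly
correlated dilates and no bounded-depth ends structure.) -/
theorem stub_transfer :
    ∀ A : ℕ, ∀ τ : ℝ, 0 < τ → ∃ D₀ : ℕ, ∃ B : Set ℕ,
      (∀ T : Finset ℕ, (∀ p ∈ T, p ∈ B) → ∑ p ∈ T, (1 : ℝ) / p ≤ 1) ∧
      ∀ D : ℕ, D₀ ≤ D → ∀ H : ℕ, ∀ᶠ n : ℕ in atTop,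
      ∀ P : MvPolynomial (Fin n) (ZMod 2), P.totalDegree ≤ Nat.log 2 n ^ A →
        ∃ k m : ℕ, (k + m) ^ 3 ≤ n ∧ ∃ g : ℕ → ℕ → ℝ, (∀ a j, |g a j| ≤ 1) ∧
          ∃ G : ℕ → ℝ, (∀ N, |G N| ≤ 1) ∧
            (∑ N ∈ range (2 ^ n),
                |(if MvPolynomial.eval (fun i : Fin n => if Nat.testBit N i then (1 : ZMod 2) else 0) P
                      = 1 then (-1 : ℝ) else 1) -
                  g (N % 2 ^ k) (N / 2 ^ (n - m)) - 2 * G N| ≤ τ * 2 ^ n) ∧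
            ∀ p q : ℕ, p.Prime → q.Prime → D < p → p < q → q ≤ H → p ∉ B → q ∉ B →
              |∑ m' ∈ Icc 1 ((2 ^ n - 1) / q), G (p * m') * G (q * m')| ≤
                τ * (((2 ^ n - 1) / q : ℕ) : ℝ) := by
  sorry

/-- **Stub (prime dilates of a single binary digit decorrelate).** There is an absolute `C` such
that for all odd primes `p < q`, every digit position `j` and every length `M`,
`|Σ_{1 ≤ m ≤ M} (−1)^{bit_j(pm)} (−1)^{bit_j(qm)}| ≤ C M/(pq) + C M q²(j+1)/2^j + C 2^j`:
complete the sum to periods `2^{j+1}` (cost `2^{j+2}`), expand the digit square wave on `ℤ/2^{j+1}`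
in its (odd-frequency) Fourier series with `|r̂(ξ)| ≤ 1/(2^{j+1}|sin(πξ/2^{j+1})|)`, and bound
`Σ_ξ |r̂(ξ)||r̂(q p⁻¹ ξ)|`: the family `p ∣ ξ` gives `O(1/(pq))`, every other solution of
`p y ≡ q ξ (2^{j+1})` has `max(|ξ|,|y|) ≥ 2^j/q`. The base case of the transfer (the "`1/(pq)`"
correlations of the card); registered as a support, not consumed by `DigitPolyUniformity_of`. -/
theorem stub_singleDigit :
    ∃ C : ℝ, ∀ p q j M : ℕ, p.Prime → q.Prime → 2 < p → p < q →
      |∑ m ∈ Icc 1 M, (if Nat.testBit (p * m) j then (-1 : ℝ) else 1) *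
          (if Nat.testBit (q * m) j then (-1 : ℝ) else 1)| ≤
        C * M / (p * q) + C * M * (q : ℝ) ^ 2 * (j + 1) / 2 ^ j + C * 2 ^ j := by
  sorry


/-! `stub_walshGapped` (prime dilates of GAP-SEPARATED Walsh characters: for odd coprime `p, q`, positions
all `≥ G` and pairwise `≥ G` apart, `|Σ_{1≤x≤M} w_S(px) w_S(qx) − M/(pq)^{#S}| ≤ (M+1)·#S·2(p+q)/2^G + 2^{L+1}`)
is LANDED: `Theorems/MobiusLadderDigitPolyUniformityWalshGappedLemmas.lean` (p104199: cancellation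
identity, CRT mean `Σ_{c<pq}(−1)^{⌊c/q⌋+⌊c/p⌋} = 1`, shifted Riemann sums) and
`Theorems/MobiusLadderDigitPolyUniformityWalshGapped.lean` (p105522: the Riesz product along the
doubling map `abs_sum_range_prod_sub_le` and `stub_walshGapped`), lead; imported above. -/

/-- **Stub (the degree-one core of the transfer, in Riesz-product form — OPEN; lead's cycle-2 target
and the disprover's sharpest test).** Uniform smallness of the doubling-map Riesz products of
`σ_{pq}(u) = (−1)^{⌊pu⌋+⌊qu⌋}` over ALL nonempty finite sets of scales (dense clusters included), for
prime pairs above `D₀(τ)` outside a thin exceptional set `B` and scales above `k₀(τ, H)`: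
`|Σ_{x<2^L} Π_{i∈S} (−1)^{⌊p(x mod 2^i)/2^i⌋+⌊q(x mod 2^i)/2^i⌋}| ≤ τ 2^L` for `S ⊆ [k₀, L)` nonempty.
By the cancellation identity (`MobiusLadderDigitPolyUniformityWalshGappedLemmas`) the summand is
`w_S(px) w_S(qx)`, so this is exactly the prime-dilate decorrelation of every Walsh character with a
digit in `[k₀, L)`, one period at a time. PROVED when `S` is `G`-separated with `2^G ≫ #S(p+q)/τ`
(`stub_walshGapped`: value `(pq)^{−#S} + O(#S(p+q)/2^G)`); open for dense clusters (Thue–Morse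
windows, Rudin–Shapiro), where numerics give `≲ 0.02` at `(17,19)…(47,61)` and decay in `L`; the thin
set `B` is necessary (`R_{29,31}({0,5}) = 0.1255`, note `AllPairsTransferNegativeNote.md`).
Registered as a support; not consumed by `DigitPolyUniformity_of`. -/
theorem stub_rieszWalsh :
    ∀ τ : ℝ, 0 < τ → ∃ D₀ : ℕ, ∃ B : Set ℕ,
      (∀ T : Finset ℕ, (∀ p ∈ T, p ∈ B) → ∑ p ∈ T, (1 : ℝ) / p ≤ 1) ∧
      ∀ H : ℕ, ∃ k₀ : ℕ, ∀ p q : ℕ, p.Prime → q.Prime → D₀ < p → p < q → q ≤ H → p ∉ B → q ∉ B →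
        ∀ L : ℕ, ∀ S : Finset ℕ, S.Nonempty → (∀ i ∈ S, k₀ ≤ i ∧ i < L) →
          |∑ x ∈ range (2 ^ L),
              ∏ i ∈ S, (-1 : ℝ) ^ (p * (x % 2 ^ i) / 2 ^ i + q * (x % 2 ^ i) / 2 ^ i)| ≤ τ * 2 ^ L := by
  sorry

/-! ### The composition -/

/-- `|λ(N)| ≤ 1` in the cast used by the route file. [folklore] -/
theorem abs_liouville_cast_le_one (N : ℕ) :
    |((ArithmeticFunction.liouville N : ℤ) : ℝ)| ≤ 1 :=
  Literature.NumberTheory.LFunctions.LiouvilleSum.abs_liouville_le_one N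

/-- **Composition (registered form): the crux from `stub_bsz`, `stub_ends`, `stub_transfer`.**
Given `A, ε`: take `τ, D₁` from `stub_bsz` at `ε/8`; `D₀, B` from `stub_transfer` at
`τ' = min τ (ε/4)`; `D = max D₀ D₁`; `H, N₀` from `stub_bsz` (fed `B`); then eventually in `n` decompose
`F_P = g + 2G + E` and bound `Σ λ g` by `stub_ends` (`ε/4`), `2 Σ λ G` by `stub_bsz` at
`N = 2^n − 1` (`2 · ε/8`), and `Σ λ E` trivially (`τ' ≤ ε/4`). -/
theorem DigitPolyUniformity_of : DigitPolyUniformity := by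
  unfold DigitPolyUniformity
  intro A ε hε
  obtain ⟨τ, hτ, D₁, hB⟩ := stub_bsz (ε / 8) (by positivity)
  obtain ⟨D₀, B, hBthin, hT⟩ := stub_transfer A (min τ (ε / 4)) (lt_min hτ (by positivity))
  have hτ'τ : min τ (ε / 4) ≤ τ := min_le_left _ _
  have hτ'ε : min τ (ε / 4) ≤ ε / 4 := min_le_right _ _
  obtain ⟨H, N₀, hB'⟩ := hB (max D₀ D₁) (le_max_right _ _) B hBthin
  have hT' := hT (max D₀ D₁) (le_max_left _ _) H
  have hE := stub_ends (ε / 4) (by positivity)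
  have hN₀ : ∀ᶠ n : ℕ in atTop, N₀ ≤ 2 ^ n - 1 := by
    have h := (tendsto_pow_atTop_atTop_of_one_lt (one_lt_two : (1 : ℕ) < 2)).eventually_ge_atTop
      (N₀ + 1)
    exact h.mono fun n hn => by omega
  filter_upwards [hT', hE, hN₀] with n hTn hEn hNn
  intro P hP
  obtain ⟨k, m, hkm, g, hg, G, hG, hL1, hpairs⟩ := hTn P hP
  have h2n : (0 : ℝ) < 2 ^ n := pow_pos two_pos n
  -- the decomposition of the correlation sum
  have hdecomp :
      ∑ N ∈ range (2 ^ n), ((ArithmeticFunction.liouville N : ℤ) : ℝ) *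
          (if MvPolynomial.eval (fun i : Fin n => if Nat.testBit N i then (1 : ZMod 2) else 0) P = 1
            then (-1 : ℝ) else 1) =
        ∑ N ∈ range (2 ^ n), ((ArithmeticFunction.liouville N : ℤ) : ℝ) *
            g (N % 2 ^ k) (N / 2 ^ (n - m)) +
          2 * ∑ N ∈ range (2 ^ n), ((ArithmeticFunction.liouville N : ℤ) : ℝ) * G N +
          ∑ N ∈ range (2 ^ n), ((ArithmeticFunction.liouville N : ℤ) : ℝ) *
            ((if MvPolynomial.eval (fun i : Fin n => if Nat.testBit N i then (1 : ZMod 2) else 0) P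
                  = 1 then (-1 : ℝ) else 1) -
              g (N % 2 ^ k) (N / 2 ^ (n - m)) - 2 * G N) := by
    rw [Finset.mul_sum, ← Finset.sum_add_distrib, ← Finset.sum_add_distrib]
    refine Finset.sum_congr rfl fun N _ => ?_
    ring
  -- term 1: ends equidistribution
  have h1 : |∑ N ∈ range (2 ^ n), ((ArithmeticFunction.liouville N : ℤ) : ℝ) *
      g (N % 2 ^ k) (N / 2 ^ (n - m))| ≤ ε / 4 * 2 ^ n := hEn k m hkm g hg
  -- term 3: the L¹-small remainder
  have h3 : |∑ N ∈ range (2 ^ n), ((ArithmeticFunction.liouville N : ℤ) : ℝ) *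
      ((if MvPolynomial.eval (fun i : Fin n => if Nat.testBit N i then (1 : ZMod 2) else 0) P = 1
          then (-1 : ℝ) else 1) - g (N % 2 ^ k) (N / 2 ^ (n - m)) - 2 * G N)| ≤ ε / 4 * 2 ^ n := by
    calc |∑ N ∈ range (2 ^ n), ((ArithmeticFunction.liouville N : ℤ) : ℝ) *
          ((if MvPolynomial.eval (fun i : Fin n => if Nat.testBit N i then (1 : ZMod 2) else 0) P
                = 1 then (-1 : ℝ) else 1) - g (N % 2 ^ k) (N / 2 ^ (n - m)) - 2 * G N)|
        ≤ ∑ N ∈ range (2 ^ n), |((ArithmeticFunction.liouville N : ℤ) : ℝ) *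
          ((if MvPolynomial.eval (fun i : Fin n => if Nat.testBit N i then (1 : ZMod 2) else 0) P
                = 1 then (-1 : ℝ) else 1) - g (N % 2 ^ k) (N / 2 ^ (n - m)) - 2 * G N)| :=
          Finset.abs_sum_le_sum_abs _ _
      _ ≤ ∑ N ∈ range (2 ^ n),
          |(if MvPolynomial.eval (fun i : Fin n => if Nat.testBit N i then (1 : ZMod 2) else 0) P
                = 1 then (-1 : ℝ) else 1) - g (N % 2 ^ k) (N / 2 ^ (n - m)) - 2 * G N| := by
          refine Finset.sum_le_sum fun N _ => ?_
          rw [abs_mul]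
          exact mul_le_of_le_one_left (abs_nonneg _) (abs_liouville_cast_le_one N)
      _ ≤ min τ (ε / 4) * 2 ^ n := hL1
      _ ≤ ε / 4 * 2 ^ n := mul_le_mul_of_nonneg_right hτ'ε h2n.le
  -- term 2: the Kátai–BSZ criterion at `N = 2^n - 1`
  have h2 : |∑ N ∈ range (2 ^ n), ((ArithmeticFunction.liouville N : ℤ) : ℝ) * G N| ≤
      ε / 8 * ((2 ^ n - 1 : ℕ) : ℝ) := by
    have hrange : range (2 ^ n) = range (2 ^ n - 1 + 1) := by
      rw [Nat.sub_add_cancel Nat.one_le_two_pow]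
    rw [hrange]
    refine hB' (2 ^ n - 1) hNn G hG ?_
    intro p q hp hq hDp hpq hqH hpB hqB
    exact (hpairs p q hp hq hDp hpq hqH hpB hqB).trans
      (mul_le_mul_of_nonneg_right hτ'τ (Nat.cast_nonneg _))
  have hcast : ((2 ^ n - 1 : ℕ) : ℝ) ≤ (2 : ℝ) ^ n := by
    exact_mod_cast Nat.sub_le (2 ^ n) 1
  have h2' : |2 * ∑ N ∈ range (2 ^ n), ((ArithmeticFunction.liouville N : ℤ) : ℝ) * G N| ≤
      ε / 4 * 2 ^ n := by
    rw [abs_mul, abs_two]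
    have h8 : ε / 8 * ((2 ^ n - 1 : ℕ) : ℝ) ≤ ε / 8 * 2 ^ n :=
      mul_le_mul_of_nonneg_left hcast (by positivity)
    linarith [h2, h8]
  rw [hdecomp]
  calc _ ≤ |∑ N ∈ range (2 ^ n), ((ArithmeticFunction.liouville N : ℤ) : ℝ) *
            g (N % 2 ^ k) (N / 2 ^ (n - m)) +
          2 * ∑ N ∈ range (2 ^ n), ((ArithmeticFunction.liouville N : ℤ) : ℝ) * G N| +
        |∑ N ∈ range (2 ^ n), ((ArithmeticFunction.liouville N : ℤ) : ℝ) *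
            ((if MvPolynomial.eval (fun i : Fin n => if Nat.testBit N i then (1 : ZMod 2) else 0) P
                  = 1 then (-1 : ℝ) else 1) -
              g (N % 2 ^ k) (N / 2 ^ (n - m)) - 2 * G N)| := abs_add_le _ _
    _ ≤ (|∑ N ∈ range (2 ^ n), ((ArithmeticFunction.liouville N : ℤ) : ℝ) *
            g (N % 2 ^ k) (N / 2 ^ (n - m))| +
          |2 * ∑ N ∈ range (2 ^ n), ((ArithmeticFunction.liouville N : ℤ) : ℝ) * G N|) +
        ε / 4 * 2 ^ n := add_le_add (abs_add_le _ _) h3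
    _ ≤ (ε / 4 * 2 ^ n + ε / 4 * 2 ^ n) + ε / 4 * 2 ^ n := by linarith [h1, h2']
    _ ≤ ε * 2 ^ n := by nlinarith [hε, h2n]

end Summit.QuantumAdvantage.DigitPolyUniformity.Sketch

end
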